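import Summits.QuantumFields.YangMills.Theorems.UnitScaleTiltProp7LatticeBoxPotentialAlgebra
import HarnessLib

/-!
# Route `UnitScaleTilt`, crux K1 «MinimiserStabilityRegPr» (stmt-QuantumFields-19200), LANE II «DIVERGENCE RECOVERY AT CURVED `W`» (★★OWNER RULING №23),
# ★p1 g19 NAMER WORD №13 [I-4] row `h4` (px12 g7 ■ hand-over; ★★OWNER ACK 102 default to w4 g11), part 1∕2 (the `ℤᵈ` brick):
# **THE BOX FRIEDRICHS BOUND FOR THE LOCAL RESIDUAL `r = y − ∇_Vφ`** — (B1′) ✓`sum_sq_le_box_friedrichs_plaq` applied to the residual one-form of (B8)'s local Coulomb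
# potential: its covariant curl is `curl_V y` minus the holonomy defect `curl_V ∇_Vφ = (R(P₁) − R(P₂))φ` (✓`norm_covCurl_grad_le_of_plaqSmall`), its graph divergence is the
# axial-constant source of (B8)'s Euler–Lagrange identity; both defects are absorbed under an `R²α`-window, leaving
# `Σ_{Q_R}‖r‖² ≤ 6N(2R+1)²·CURL_in(y) + 24N(2R+1)²d²·π₀·α²·G(φ)` (`π₀` = the box Poincaré constant of `φ`, `G(φ) = Σ_inside‖∇_Vφ‖²`).

Cell `ym3-torus`, width seat `ym-ust-19200-w4` (gen 11).  THEOREMS ONLY (0 `def`, 0 `sorry`); `--supports stmt-QuantumFields-19200 --as helper`, count-neutral; consumer-independent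
`ℤᵈ` letters (those of ✓`Prop7LatticeBoxFriedrichsCurved` ∕ ✓`Prop7LatticeBoxLocalPotential` VERBATIM).  YM₃ on T³ is a ladder rung (R3), not d = 4, not infinite volume, not the Clay
problem; nothing here claims [Balaban1985BackgroundPropagators] Thm 3.3 ∕ 3.11, `hN06`, (REC), EX, the crux or the gap.

THE PRINT.  [Balaban1985BackgroundPropagators] (3.8)–(3.10) p.392 (covariant derivative, divergence, curl; «Δ′ will be a bounded, small operator»), (3.23) p.394 (the local
Coulomb potential); [Balaban1984PropagatorsI] Prop. 1.1 p.33 (the Friedrichs ∕ Poincaré mechanism on blocks); [Balaban1985Averaging] pp.24–25 (axial gauge of a small-plaquette background).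

WHAT IS PROVED (ns `…Theorems.Prop7LatticeBoxResidualFriedrichs`; box `Q_R(z) = box z R ⊂ ℤᵈ`, `V` in lit `B7Prop1Explicit.U1`, `R(u)X = conjR u X`):
* §1 `mem_box_add_of_mem_add_add` (order-interval betweenness: `x, x+e_μ+e_ν ∈ Q_R ⇒ x+e_μ ∈ Q_R`), `sum_ite_shift_two_le` (`Σ_{x∈Q_R}Σ_μΣ_ν [x+e_μ+e_ν ∈ Q_R]·f(x+e_μ+e_ν) ≤ d²·Σ_{Q_R} f`
  for `f ≥ 0`).
* §2 ★`curl_residual_le`: for a one-form `g` that equals `y − ∇_Vφ` on the inside edges of `Q_R(z)` and `PlaqSmall V (z−R) (z+R) α`: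
  `CURL_in(g) ≤ 2·CURL_in(y) + 8α²d²·Σ_{Q_R}‖φ‖²` (the (B1′) curl token: all ordered pairs `μ, ν`, indicator `[x+e_μ+e_ν ∈ Q_R]`, operator norms).
* §3 ★★★`sum_sq_residual_le`: if moreover `g` lives on the inside edges, its (B1′) divergence functional is `≤ σ·Σ‖g‖²`, `Σ_{Q_R}‖φ‖² ≤ π₀·G(φ)` and the window
  `2N(2R+1)²σ + 80d³N(2R+1)²R²α² ≤ ½` holds, then `Σ_{Q_R}Σ_μ‖g‖² ≤ 6N(2R+1)²·CURL_in(y) + 24N(2R+1)²d²π₀α²·G(φ)`.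
HONEST SCOPE.  Lattice bookkeeping over landed bricks ((B1′), (B8) §5); the member reading (row `h4` at ★p1's `hPatch` letters) is part 2∕2; nothing of print asserted; rung R3, not Clay;
YM gap NOT proved.

References: T. Bałaban, CMP **99** (1985) 389–434 [Balaban1985BackgroundPropagators] ((3.8)–(3.10) p.392, (3.23) p.394); CMP **95** (1984) 17–40 [Balaban1984PropagatorsI] (Prop. 1.1
p.33); CMP **98** (1985) 17–51 [Balaban1985Averaging] (pp.24–25); M. Giaquinta, *Multiple integrals in the calculus of variations and nonlinear elliptic systems* (1983) [Giaquinta1984] (Ch. III §1).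
-/

set_option autoImplicit false

noncomputable section

open scoped BigOperators Matrix.Norms.L2Operator
open Finset

namespace Summit.QuantumFields.YangMills.Theorems.Prop7LatticeBoxResidualFriedrichs

open Literature.MathematicalPhysics.QuantumFieldTheory.Balaban1983to89
open Literature.MathematicalPhysics.QuantumFieldTheory.Balaban1983to89.B4Eq19LatticeOperators
open B7Prop1Explicit (U1)
open B7Eq78Linearization (conjR conjR_sub conjR_add)
open B8Ineq132 (norm_conjR conjR_conjR)
open Summit.QuantumFields.YangMills.Theorems.Prop7LatticeBoxFriedrichsCurved (sum_sq_le_box_friedrichs_plaq mem_box_iff_le unitVec_eq_e)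
open Summit.QuantumFields.YangMills.Theorems.Prop7LatticeBoxPotentialAlgebra (norm_covCurl_grad_le_of_plaqSmall)

variable {d N : ℕ}

/-! ## §1 Box bookkeeping -/

section Box

/-- The unit vector has nonnegative coordinates. [folklore] -/
theorem unitVec_apply_nonneg (μ : Fin d) (i : Fin d) : (0 : ℤ) ≤ (unitVec μ : Zd d) i := by
  by_cases h : i = μ
  · subst h; rw [unitVec_apply_self]; norm_num
  · rw [unitVec_apply_ne h]

/-- **ORDER-INTERVAL BETWEENNESS**: if `x` and `x + e_μ + e_ν` lie in `Q_R(z)`, so does `x + e_μ`. [folklore] [cite: Giaquinta1984, Ch. III §1 p.64] -/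
theorem mem_box_add_of_mem_add_add {z x : Zd d} {R : ℤ} {μ ν : Fin d} (hx : x ∈ box z R) (hxμν : x + unitVec μ + unitVec ν ∈ box z R) :
    x + unitVec μ ∈ box z R := by
  rw [mem_box_iff_le] at hx hxμν ⊢
  refine ⟨fun i => ?_, fun i => ?_⟩
  · have h1 := hx.1 i
    have h0 := unitVec_apply_nonneg μ i
    simp only [Pi.add_apply] at h1 ⊢
    linarith
  · have h2 := hxμν.2 i
    have h0 := unitVec_apply_nonneg ν i
    simp only [Pi.add_apply] at h2 ⊢
    linarith

/-- The second shifted corner: `x, x+e_μ+e_ν ∈ Q_R ⇒ x+e_ν ∈ Q_R`. [folklore] [cite: Giaquinta1984, Ch. III §1 p.64] -/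
theorem mem_box_add_of_mem_add_add' {z x : Zd d} {R : ℤ} {μ ν : Fin d} (hx : x ∈ box z R) (hxμν : x + unitVec μ + unitVec ν ∈ box z R) :
    x + unitVec ν ∈ box z R := by
  rw [add_right_comm] at hxμν
  exact mem_box_add_of_mem_add_add hx hxμν

/-- **SHIFTED INDICATOR SUMS ARE DOMINATED**: `Σ_{x ∈ Q_R} [x+e_μ+e_ν ∈ Q_R]·f(x+e_μ+e_ν) ≤ Σ_{Q_R} f` for `f ≥ 0` on the box (the shift is injective). [folklore] -/
theorem sum_ite_shift_le (z : Zd d) (R : ℤ) (μ ν : Fin d) (f : Zd d → ℝ) (hf : ∀ w ∈ box z R, 0 ≤ f w) :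
    ∑ x ∈ box z R, (if x + unitVec μ + unitVec ν ∈ box z R then f (x + unitVec μ + unitVec ν) else 0) ≤ ∑ w ∈ box z R, f w := by
  classical
  rw [← Finset.sum_filter]
  have hinj : Set.InjOn (fun x : Zd d => x + unitVec μ + unitVec ν) ↑((box z R).filter (fun x => x + unitVec μ + unitVec ν ∈ box z R)) := by
    intro x _ x' _ h
    simpa [add_assoc] using h
  rw [← Finset.sum_image (f := f) hinj]
  refine Finset.sum_le_sum_of_subset_of_nonneg (fun w hw => ?_) (fun w hw _ => hf w hw)
  rw [Finset.mem_image] at hw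
  obtain ⟨x, hx, rfl⟩ := hw
  exact (Finset.mem_filter.1 hx).2

/-- … summed over all ordered pairs of directions: `≤ d²·Σ_{Q_R} f`. [folklore] -/
theorem sum_ite_shift_two_le (z : Zd d) (R : ℤ) (f : Zd d → ℝ) (hf : ∀ w ∈ box z R, 0 ≤ f w) :
    ∑ x ∈ box z R, ∑ μ : Fin d, ∑ ν : Fin d, (if x + unitVec μ + unitVec ν ∈ box z R then f (x + unitVec μ + unitVec ν) else 0)
      ≤ (d : ℝ) ^ 2 * ∑ w ∈ box z R, f w := by
  rw [Finset.sum_comm]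
  calc ∑ μ : Fin d, ∑ x ∈ box z R, ∑ ν : Fin d, (if x + unitVec μ + unitVec ν ∈ box z R then f (x + unitVec μ + unitVec ν) else 0)
      = ∑ μ : Fin d, ∑ ν : Fin d, ∑ x ∈ box z R, (if x + unitVec μ + unitVec ν ∈ box z R then f (x + unitVec μ + unitVec ν) else 0) := by
        refine Finset.sum_congr rfl fun μ _ => ?_
        rw [Finset.sum_comm]
    _ ≤ ∑ μ : Fin d, ∑ ν : Fin d, ∑ w ∈ box z R, f w :=
        Finset.sum_le_sum fun μ _ => Finset.sum_le_sum fun ν _ => sum_ite_shift_le z R μ ν f hf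
    _ = (d : ℝ) ^ 2 * ∑ w ∈ box z R, f w := by
        simp only [Finset.sum_const, Finset.card_univ, Fintype.card_fin, nsmul_eq_mul]
        ring

end Box

/-! ## §2 The covariant curl of the residual -/

section Curl

variable [NeZero N]

/-- ★ **THE CURL OF THE LOCAL RESIDUAL**: for a one-form `g` equal to `y − ∇_Vφ` on the inside edges of `Q_R(z)` and a background whose box plaquettes are `α`-close to `1`,
`Σ_{Q_R}Σ_μΣ_ν [x+e_μ+e_ν ∈ Q_R]·‖curl_V g‖² ≤ 2·Σ[…]‖curl_V y‖² + 8α²d²·Σ_{Q_R}‖φ‖²` — `curl_V ∇_Vφ` is the holonomy defect `(R(P₁) − R(P₂))φ` of size `≤ 2α‖φ‖`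
(✓`Prop7LatticeBoxPotentialAlgebra.norm_covCurl_grad_le_of_plaqSmall`). [cite: Balaban1985BackgroundPropagators, (3.10) p.392] -/
theorem curl_residual_le {z : Zd d} {R : ℤ} {α : ℝ} (hα : 0 ≤ α)
    (V : Zd d → Fin d → (Matrix (Fin N) (Fin N) ℂ)ˣ) (hV : ∀ x μ, V x μ ∈ U1 (Matrix (Fin N) (Fin N) ℂ))
    (hP : B8Lemma1NonAbelian.PlaqSmall V (fun i => z i - R) (fun i => z i + R) α)
    (y : Zd d → Fin d → Matrix (Fin N) (Fin N) ℂ) (φ : Zd d → Matrix (Fin N) (Fin N) ℂ) (g : Zd d → Fin d → Matrix (Fin N) (Fin N) ℂ)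
    (hg1 : ∀ x ∈ box z R, ∀ μ, x + unitVec μ ∈ box z R → g x μ = y x μ - (conjR (V x μ) (φ (x + unitVec μ)) - φ x)) :
    ∑ x ∈ box z R, ∑ μ, ∑ ν, (if x + unitVec μ + unitVec ν ∈ box z R then
        ‖g x μ + conjR (V x μ) (g (x + unitVec μ) ν) - conjR (V x ν) (g (x + unitVec ν) μ) - g x ν‖ ^ 2 else 0)
      ≤ 2 * ∑ x ∈ box z R, ∑ μ, ∑ ν, (if x + unitVec μ + unitVec ν ∈ box z R then
            ‖y x μ + conjR (V x μ) (y (x + unitVec μ) ν) - conjR (V x ν) (y (x + unitVec ν) μ) - y x ν‖ ^ 2 else 0)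
        + 8 * α ^ 2 * (d : ℝ) ^ 2 * ∑ x ∈ box z R, ‖φ x‖ ^ 2 := by
  -- pointwise
  have hpt : ∀ x ∈ box z R, ∀ μ ν, x + unitVec μ + unitVec ν ∈ box z R →
      ‖g x μ + conjR (V x μ) (g (x + unitVec μ) ν) - conjR (V x ν) (g (x + unitVec ν) μ) - g x ν‖ ^ 2
        ≤ 2 * ‖y x μ + conjR (V x μ) (y (x + unitVec μ) ν) - conjR (V x ν) (y (x + unitVec ν) μ) - y x ν‖ ^ 2
          + 8 * α ^ 2 * ‖φ (x + unitVec μ + unitVec ν)‖ ^ 2 := by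
    intro x hx μ ν hxμν
    have hxμ : x + unitVec μ ∈ box z R := mem_box_add_of_mem_add_add hx hxμν
    have hxν : x + unitVec ν ∈ box z R := mem_box_add_of_mem_add_add' hx hxμν
    have hxνμ : x + unitVec ν + unitVec μ ∈ box z R := by rw [add_right_comm]; exact hxμν
    rw [hg1 x hx μ hxμ, hg1 x hx ν hxν, hg1 _ hxμ ν hxμν, hg1 _ hxν μ hxνμ]
    have hcurl := norm_covCurl_grad_le_of_plaqSmall hα V hV hP φ x μ ν hx hxμν
    set a := y x μ + conjR (V x μ) (y (x + unitVec μ) ν) - conjR (V x ν) (y (x + unitVec ν) μ) - y x ν with ha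
    set b := (conjR (V x μ) (φ (x + unitVec μ)) - φ x)
        + conjR (V x μ) (conjR (V (x + unitVec μ) ν) (φ (x + unitVec μ + unitVec ν)) - φ (x + unitVec μ))
        - conjR (V x ν) (conjR (V (x + unitVec ν) μ) (φ (x + unitVec ν + unitVec μ)) - φ (x + unitVec ν))
        - (conjR (V x ν) (φ (x + unitVec ν)) - φ x) with hb
    have hid : y x μ - (conjR (V x μ) (φ (x + unitVec μ)) - φ x)
        + conjR (V x μ) (y (x + unitVec μ) ν - (conjR (V (x + unitVec μ) ν) (φ (x + unitVec μ + unitVec ν)) - φ (x + unitVec μ)))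
        - conjR (V x ν) (y (x + unitVec ν) μ - (conjR (V (x + unitVec ν) μ) (φ (x + unitVec ν + unitVec μ)) - φ (x + unitVec ν)))
        - (y x ν - (conjR (V x ν) (φ (x + unitVec ν)) - φ x)) = a - b := by
      simp only [ha, hb, conjR_sub]; abel
    rw [hid]
    have hb2 : ‖b‖ ^ 2 ≤ 4 * α ^ 2 * ‖φ (x + unitVec μ + unitVec ν)‖ ^ 2 := by
      have h0 := pow_le_pow_left₀ (norm_nonneg b) hcurl 2
      have e : (2 * α * ‖φ (x + unitVec μ + unitVec ν)‖) ^ 2 = 4 * α ^ 2 * ‖φ (x + unitVec μ + unitVec ν)‖ ^ 2 := by ring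
      rw [e] at h0; exact h0
    have hab : ‖a - b‖ ^ 2 ≤ 2 * ‖a‖ ^ 2 + 2 * ‖b‖ ^ 2 := by
      nlinarith [norm_sub_le a b, norm_nonneg a, norm_nonneg b, norm_nonneg (a - b), sq_nonneg (‖a‖ - ‖b‖)]
    linarith [hab, hb2]
  -- sum
  have hsum : ∑ x ∈ box z R, ∑ μ, ∑ ν, (if x + unitVec μ + unitVec ν ∈ box z R then
        ‖g x μ + conjR (V x μ) (g (x + unitVec μ) ν) - conjR (V x ν) (g (x + unitVec ν) μ) - g x ν‖ ^ 2 else 0)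
      ≤ ∑ x ∈ box z R, ∑ μ, ∑ ν, ((if x + unitVec μ + unitVec ν ∈ box z R then
            2 * ‖y x μ + conjR (V x μ) (y (x + unitVec μ) ν) - conjR (V x ν) (y (x + unitVec ν) μ) - y x ν‖ ^ 2 else 0)
          + (if x + unitVec μ + unitVec ν ∈ box z R then 8 * α ^ 2 * ‖φ (x + unitVec μ + unitVec ν)‖ ^ 2 else 0)) := by
    refine Finset.sum_le_sum fun x hx => Finset.sum_le_sum fun μ _ => Finset.sum_le_sum fun ν _ => ?_
    split_ifs with h
    · exact hpt x hx μ ν h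
    · simp
  refine hsum.trans ?_
  simp only [Finset.sum_add_distrib]
  have h1 : ∑ x ∈ box z R, ∑ μ, ∑ ν, (if x + unitVec μ + unitVec ν ∈ box z R then
        2 * ‖y x μ + conjR (V x μ) (y (x + unitVec μ) ν) - conjR (V x ν) (y (x + unitVec ν) μ) - y x ν‖ ^ 2 else 0)
      = 2 * ∑ x ∈ box z R, ∑ μ, ∑ ν, (if x + unitVec μ + unitVec ν ∈ box z R then
        ‖y x μ + conjR (V x μ) (y (x + unitVec μ) ν) - conjR (V x ν) (y (x + unitVec ν) μ) - y x ν‖ ^ 2 else 0) := by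
    rw [Finset.mul_sum]
    refine Finset.sum_congr rfl fun x _ => ?_
    rw [Finset.mul_sum]
    refine Finset.sum_congr rfl fun μ _ => ?_
    rw [Finset.mul_sum]
    refine Finset.sum_congr rfl fun ν _ => ?_
    split_ifs <;> simp
  have h2 : ∑ x ∈ box z R, ∑ μ, ∑ ν, (if x + unitVec μ + unitVec ν ∈ box z R then 8 * α ^ 2 * ‖φ (x + unitVec μ + unitVec ν)‖ ^ 2 else 0)
      = 8 * α ^ 2 * ∑ x ∈ box z R, ∑ μ, ∑ ν, (if x + unitVec μ + unitVec ν ∈ box z R then ‖φ (x + unitVec μ + unitVec ν)‖ ^ 2 else 0) := by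
    rw [Finset.mul_sum]
    refine Finset.sum_congr rfl fun x _ => ?_
    rw [Finset.mul_sum]
    refine Finset.sum_congr rfl fun μ _ => ?_
    rw [Finset.mul_sum]
    refine Finset.sum_congr rfl fun ν _ => ?_
    split_ifs <;> simp
  rw [h1, h2]
  have h3 := sum_ite_shift_two_le z R (fun w => ‖φ w‖ ^ 2) (fun w _ => sq_nonneg _)
  have hα2 : 0 ≤ 8 * α ^ 2 := by positivity
  have h4 := mul_le_mul_of_nonneg_left h3 hα2
  have e : 8 * α ^ 2 * ((d : ℝ) ^ 2 * ∑ w ∈ box z R, ‖φ w‖ ^ 2) = 8 * α ^ 2 * (d : ℝ) ^ 2 * ∑ x ∈ box z R, ‖φ x‖ ^ 2 := by ring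
  rw [e] at h4
  linarith

end Curl

/-! ## §3 The box Friedrichs bound for the residual -/

section Main

variable [NeZero N]

/-- ★★★ **THE BOX FRIEDRICHS BOUND FOR THE LOCAL RESIDUAL** (row `h4` of ★p1 g19's `hPatch`, `ℤᵈ` form).  Let `0 ≤ R`, `V` in `U1` with `PlaqSmall V (z−R) (z+R) α`, `0 ≤ α`;
let `g` live on the inside edges of `Q_R(z)` and equal `y − ∇_Vφ` there; suppose its (B1′) divergence functional is `≤ σ·Σ‖g‖²` (at (B8)'s residual: the axial-constant source,
`σ = O(d³N·R²α²)`), `Σ_{Q_R}‖φ‖² ≤ π₀·G(φ)` (the box Poincaré row, `π₀ = 4N·R(2R+1)`), and the window `2N(2R+1)²σ + 80d³N(2R+1)²R²α² ≤ ½`.  Then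
`Σ_{Q_R}Σ_μ‖g‖² ≤ 6N(2R+1)²·CURL_in(y) + 24N(2R+1)²d²π₀α²·G(φ)`.
[cite: Balaban1984PropagatorsI, Prop. 1.1 p.33; Balaban1985BackgroundPropagators, (3.8)-(3.10) p.392, (3.23) p.394] -/
theorem sum_sq_residual_le {z : Zd d} {R : ℤ} (hR : 0 ≤ R) {α : ℝ} (hα : 0 ≤ α)
    (V : Zd d → Fin d → (Matrix (Fin N) (Fin N) ℂ)ˣ) (hV : ∀ x μ, V x μ ∈ U1 (Matrix (Fin N) (Fin N) ℂ))
    (hP : B8Lemma1NonAbelian.PlaqSmall V (fun i => z i - R) (fun i => z i + R) α)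
    (y : Zd d → Fin d → Matrix (Fin N) (Fin N) ℂ) (φ : Zd d → Matrix (Fin N) (Fin N) ℂ) (g : Zd d → Fin d → Matrix (Fin N) (Fin N) ℂ)
    (hg0 : ∀ (x : Zd d) (μ : Fin d), (x ∉ box z R ∨ x + unitVec μ ∉ box z R) → g x μ = 0)
    (hg1 : ∀ x ∈ box z R, ∀ μ, x + unitVec μ ∈ box z R → g x μ = y x μ - (conjR (V x μ) (φ (x + unitVec μ)) - φ x))
    {σ π₀ : ℝ}
    (hDIV : ∑ x ∈ box z R, ‖∑ μ, (conjR (V (x - unitVec μ) μ)⁻¹ (g (x - unitVec μ) μ) - g x μ)‖ ^ 2 ≤ σ * ∑ x ∈ box z R, ∑ μ, ‖g x μ‖ ^ 2)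
    (hΦ : ∑ x ∈ box z R, ‖φ x‖ ^ 2 ≤ π₀ * ∑ x ∈ box z R, ∑ μ, (if x + unitVec μ ∈ box z R then ‖conjR (V x μ) (φ (x + unitVec μ)) - φ x‖ ^ 2 else 0))
    (hwin : 2 * N * (2 * (R : ℝ) + 1) ^ 2 * σ + 80 * (d : ℝ) ^ 3 * N * (2 * (R : ℝ) + 1) ^ 2 * R ^ 2 * α ^ 2 ≤ 1 / 2) :
    ∑ x ∈ box z R, ∑ μ, ‖g x μ‖ ^ 2
      ≤ 6 * N * (2 * (R : ℝ) + 1) ^ 2 *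
          ∑ x ∈ box z R, ∑ μ, ∑ ν, (if x + unitVec μ + unitVec ν ∈ box z R then
            ‖y x μ + conjR (V x μ) (y (x + unitVec μ) ν) - conjR (V x ν) (y (x + unitVec ν) μ) - y x ν‖ ^ 2 else 0)
        + 24 * N * (2 * (R : ℝ) + 1) ^ 2 * (d : ℝ) ^ 2 * π₀ * α ^ 2 *
          ∑ x ∈ box z R, ∑ μ, (if x + unitVec μ ∈ box z R then ‖conjR (V x μ) (φ (x + unitVec μ)) - φ x‖ ^ 2 else 0) := by
  have hF := sum_sq_le_box_friedrichs_plaq hR hα V hV hP g hg0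
  have hC := curl_residual_le hα V hV hP y φ g hg1
  set G := ∑ x ∈ box z R, ∑ μ, ‖g x μ‖ ^ 2 with hG
  set CURLg := ∑ x ∈ box z R, ∑ μ, ∑ ν, (if x + unitVec μ + unitVec ν ∈ box z R then
      ‖g x μ + conjR (V x μ) (g (x + unitVec μ) ν) - conjR (V x ν) (g (x + unitVec ν) μ) - g x ν‖ ^ 2 else 0) with hCURLg
  set CURLy := ∑ x ∈ box z R, ∑ μ, ∑ ν, (if x + unitVec μ + unitVec ν ∈ box z R then
      ‖y x μ + conjR (V x μ) (y (x + unitVec μ) ν) - conjR (V x ν) (y (x + unitVec ν) μ) - y x ν‖ ^ 2 else 0) with hCURLy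
  set DIVg := ∑ x ∈ box z R, ‖∑ μ, (conjR (V (x - unitVec μ) μ)⁻¹ (g (x - unitVec μ) μ) - g x μ)‖ ^ 2 with hDIVg
  set Φ := ∑ x ∈ box z R, ‖φ x‖ ^ 2 with hΦdef
  set Gφ := ∑ x ∈ box z R, ∑ μ, (if x + unitVec μ ∈ box z R then ‖conjR (V x μ) (φ (x + unitVec μ)) - φ x‖ ^ 2 else 0) with hGφ
  have hG0 : 0 ≤ G := by positivity
  have hCURLy0 : 0 ≤ CURLy := by
    refine Finset.sum_nonneg fun x _ => Finset.sum_nonneg fun μ _ => Finset.sum_nonneg fun ν _ => ?_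
    split_ifs <;> positivity
  have hGφ0 : 0 ≤ Gφ := by
    refine Finset.sum_nonneg fun x _ => Finset.sum_nonneg fun μ _ => ?_
    split_ifs <;> positivity
  have hN0 : (0 : ℝ) ≤ N := Nat.cast_nonneg N
  have hM : 0 ≤ (N : ℝ) * (2 * (R : ℝ) + 1) ^ 2 := by positivity
  -- Friedrichs with the curl and divergence of the residual substituted
  have h1 : G ≤ N * (2 * (R : ℝ) + 1) ^ 2 * ((3 / 2) * (2 * CURLy + 8 * α ^ 2 * (d : ℝ) ^ 2 * (π₀ * Gφ)) + 2 * (σ * G))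
      + 80 * (d : ℝ) ^ 3 * N * (2 * (R : ℝ) + 1) ^ 2 * R ^ 2 * α ^ 2 * G := by
    have hα8 : 0 ≤ 8 * α ^ 2 * (d : ℝ) ^ 2 := by positivity
    have hC' : CURLg ≤ 2 * CURLy + 8 * α ^ 2 * (d : ℝ) ^ 2 * (π₀ * Gφ) := by
      have := mul_le_mul_of_nonneg_left hΦ hα8; linarith
    have hin : (3 / 2) * CURLg + 2 * DIVg ≤ (3 / 2) * (2 * CURLy + 8 * α ^ 2 * (d : ℝ) ^ 2 * (π₀ * Gφ)) + 2 * (σ * G) := by linarith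
    have := mul_le_mul_of_nonneg_left hin hM
    linarith
  -- absorb
  have h2 : G ≤ N * (2 * (R : ℝ) + 1) ^ 2 * (3 * CURLy + 12 * α ^ 2 * (d : ℝ) ^ 2 * π₀ * Gφ) + (1 / 2) * G := by
    have hw := mul_le_mul_of_nonneg_right hwin hG0
    have e1 : N * (2 * (R : ℝ) + 1) ^ 2 * ((3 / 2) * (2 * CURLy + 8 * α ^ 2 * (d : ℝ) ^ 2 * (π₀ * Gφ)) + 2 * (σ * G))
        + 80 * (d : ℝ) ^ 3 * N * (2 * (R : ℝ) + 1) ^ 2 * R ^ 2 * α ^ 2 * G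
        = N * (2 * (R : ℝ) + 1) ^ 2 * (3 * CURLy + 12 * α ^ 2 * (d : ℝ) ^ 2 * π₀ * Gφ)
          + (2 * N * (2 * (R : ℝ) + 1) ^ 2 * σ + 80 * (d : ℝ) ^ 3 * N * (2 * (R : ℝ) + 1) ^ 2 * R ^ 2 * α ^ 2) * G := by ring
    rw [e1] at h1
    linarith
  linarith

end Main

end Summit.QuantumFields.YangMills.Theorems.Prop7LatticeBoxResidualFriedrichs

end
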